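import Summits.QuantumFields.YangMills.Theorems.UnitScaleTiltFluctuationComparisonRegPrGlobalSlackKernelLegWeights
import HarnessLib

/-!
# `UnitScaleTiltFluctuationComparisonRegPrTwoCutoffReferenceToolkit` — TWO GENERIC TOOLS FOR THE REFERENCE FORM OF THE K1a ROW: (A) a uniform two-cut-off row in a COMPLETE space
# yields a height-free reference object with the same per-run budget; (B) King's «replace factor by factor» for flat kernels precomposed with linear maps, in the leg currency
# (crux `FluctuationComparisonRegPrIntL`, stmt-QuantumFields-20520, STUB 3⁗χ; cell `pub/ym-inputs`, INPUT-LIST I-11 row p10; seat ym-inputs-p10, file 4, count-neutral helper, def-free)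

WHY.  The K1a row of 3⁗χ is recorded per run against a HEIGHT-FREE reference (`KerHeightFree Ψ`, `KernelRefΦ`, (R1) `KernelRefOwnΦ`; `…GlobalSlackKernelLegRef(Own)`), and its flat
kernels are `ker Φ K b Y d = D^d(Φ K b Y)(0)` precomposed with the leg weights `legL` (`…GlobalSlackKernelLegWeights`).  Files 1–3 of this seat built the reference objects of the
flat `A = 0` template at the propagator layer (symbol ✓ p618709, operator ✓ p619483, covariance ⧗) from the tree's uniform two-run rates by ONE mechanism.  This file isolates the
two mechanisms a definer of `ψRef`-type objects and a prover of (R1) will need, in Mathlib generality: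

* §1 **`exists_limit_of_uniform_cauchy_dist`** (complete pseudo-metric spaces) and **`exists_limit_of_uniform_cauchy_norm`** (complete normed groups — e.g. operator-valued families
  `K ↦ G^{(K)}` in `E →L[𝕜] F`): if `dist (s k) (s (k+n)) ≤ b k ≤ C·r^k` for all `k, n ≥ 1`, `r < 1`, then `s → x` and `dist (s k) x ≤ b k` for EVERY `k ≥ 1` — a uniform-in-`n`
  two-cut-off row IS a per-run row against the limit (King p.657 «Hence {Z^{ε_K}} is a Cauchy sequence and converges to a unique limit»);
* §2 **`norm_compContinuousLinearMap_sub_le`** — for a continuous `k`-linear map `g` and linear maps `A, B`: `‖g∘(A,…,A) − g∘(B,…,B)‖ ≤ k·max(‖A‖,‖B‖)^{k−1}·‖A − B‖·‖g‖`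
  (Mathlib's `compContinuousLinearMapContinuousMultilinear` has norm `≤ 1`, plus `ContinuousMultilinearMap.norm_image_sub_le`) = King's «by repeated use of the identity
  xy − zw = ½(x − y)(z + w) + ½(x + y)(z − w)» ∕ «replace … one by one every factor … and bound the error at each step» (p.664 L31–33, p.673 Lemma 4.4);
* §3 **`norm_comp_sub_comp_compLeg_le`** — THE K1a-SHAPED COROLLARY: for kernels `M, M′`, inner linear maps `T, T′` and a weight map `W` (the row's `legL`),
  `‖(M∘T^{⊗k} − M′∘T′^{⊗k})∘W^{⊗k}‖ ≤ ‖M − M′‖·‖T∘W‖^k + k·max(‖T∘W‖,‖T′∘W‖)^{k−1}·‖(T − T′)∘W‖·‖M′‖` — the two sources of a two-cut-off kernel difference (the outer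
  functional's own difference, and the propagator difference leg by leg) separated, with the leg weights absorbed into the inner maps (`compContinuousLinearMap_compLeg`).

HONEST FRAMING.  Pure functional analysis over Mathlib (no lattice object, no estimate of [Balaban1985UV3] ∕ [King1986] asserted or used); the `[cite]` tags LOCATE the printed
sentences these lemmas formalise the mechanism of.  Nothing here discharges the non-abelian row (no carrier in the tree; INPUT-LIST I-11, E2 = NO); the stub, the crux and the
(α) record are untouched.  YM₃ on T³ is a ladder rung, not the Clay problem ∕ 𝕋⁴ ∕ a mass gap; no summit or sub-problem statement is proved here.

References: C. King, CMP 102 (1986) 649–677 [King1986] (p.657 (3.13); Prop. 3.6 (3.55)–(3.56) p.662; p.664 L31–33; Lemma 4.4 (4.29)–(4.30) p.673);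
T. Bałaban, CMP 102 (1985) 255–275 [Balaban1985UV3] ((43)–(45) pp.266–267, the leg weights).
-/

set_option autoImplicit false

noncomputable section

open Filter Topology

namespace Summit.QuantumFields.YangMills.Theorems.TwoCutoffReferenceToolkit

/-! ## §1 Uniform two-cut-off rows in complete spaces give height-free references -/

/-- **UNIFORM CAUCHY ⟹ REFERENCE WITH THE SAME PER-INDEX BUDGET (complete pseudo-metric spaces)**: if `dist (s k) (s (k+n)) ≤ b k` for all `k, n ≥ 1` with `b k ≤ C·r^k`,
`r < 1`, then `s` converges to some `x` and `dist (s k) x ≤ b k` for every `k ≥ 1`. [cite: King1986, (3.13) p.657] -/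
theorem exists_limit_of_uniform_cauchy_dist {E : Type*} [PseudoMetricSpace E] [CompleteSpace E] {s : ℕ → E} {b : ℕ → ℝ} {C r : ℝ} (hr1 : r < 1)
    (hb : ∀ k : ℕ, 1 ≤ k → b k ≤ C * r ^ k) (h : ∀ k n : ℕ, 1 ≤ k → 1 ≤ n → dist (s k) (s (k + n)) ≤ b k) :
    ∃ x : E, Tendsto s atTop (𝓝 x) ∧ ∀ k : ℕ, 1 ≤ k → dist (s k) x ≤ b k := by
  have hCS : CauchySeq fun m : ℕ => s (m + 1) := by
    refine cauchySeq_of_le_geometric r (C * r) hr1 fun m => ?_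
    have h1 := h (m + 1) 1 (by omega) le_rfl
    calc dist (s (m + 1)) (s (m + 1 + 1)) ≤ b (m + 1) := h1
      _ ≤ C * r ^ (m + 1) := hb (m + 1) (by omega)
      _ = C * r * r ^ m := by ring
  obtain ⟨x, hx1⟩ := cauchySeq_tendsto_of_complete hCS
  have hx : Tendsto s atTop (𝓝 x) := (tendsto_add_atTop_iff_nat (f := s) 1).mp hx1
  refine ⟨x, hx, fun k hk => ?_⟩
  have hidx : Tendsto (fun n : ℕ => k + n) atTop atTop :=
    tendsto_atTop_atTop.mpr fun c => ⟨c, fun n hn => hn.trans (Nat.le_add_left n k)⟩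
  have hshift : Tendsto (fun n : ℕ => s (k + n)) atTop (𝓝 x) := hx.comp hidx
  have hdist : Tendsto (fun n : ℕ => dist (s k) (s (k + n))) atTop (𝓝 (dist (s k) x)) := tendsto_const_nhds.dist hshift
  refine le_of_tendsto hdist ?_
  filter_upwards [eventually_ge_atTop 1] with n hn
  exact h k n hk hn

/-- **The same in a complete normed group** (`‖s k − s (k+n)‖ ≤ b k` ⟹ `‖s k − x‖ ≤ b k`): the form used for operator-valued families `K ↦ G^{(K)}` in `E →L[𝕜] F`
(complete when `F` is) and for kernel families in `ContinuousMultilinearMap`. [cite: King1986, (3.13) p.657; Prop. 3.6 (3.56) p.662] -/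
theorem exists_limit_of_uniform_cauchy_norm {E : Type*} [NormedAddCommGroup E] [CompleteSpace E] {s : ℕ → E} {b : ℕ → ℝ} {C r : ℝ} (hr1 : r < 1)
    (hb : ∀ k : ℕ, 1 ≤ k → b k ≤ C * r ^ k) (h : ∀ k n : ℕ, 1 ≤ k → 1 ≤ n → ‖s k - s (k + n)‖ ≤ b k) :
    ∃ x : E, Tendsto s atTop (𝓝 x) ∧ ∀ k : ℕ, 1 ≤ k → ‖s k - x‖ ≤ b k := by
  obtain ⟨x, hx, hrate⟩ := exists_limit_of_uniform_cauchy_dist (s := s) hr1 hb (fun k n hk hn => by rw [dist_eq_norm]; exact h k n hk hn)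
  exact ⟨x, hx, fun k hk => by rw [← dist_eq_norm]; exact hrate k hk⟩

/-- **The limit is unique** (Hausdorff): the reference object is determined by the family. [folklore] -/
theorem limit_unique {E : Type*} [PseudoMetricSpace E] [T2Space E] {s : ℕ → E} {x y : E}
    (hx : Tendsto s atTop (𝓝 x)) (hy : Tendsto s atTop (𝓝 y)) : x = y :=
  tendsto_nhds_unique hx hy

/-- **TWO RUNS FROM THE REFERENCE**: a per-run row against one reference gives back the two-run row with the summed budget (triangle inequality) — nothing is lost by recording
only the per-run form (the pattern of `GlobalSlackKernelLeg.flatKernelLegCauchyΦ_of_ref`). [cite: King1986, Prop. 3.6 (3.56) p.662] -/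
theorem dist_le_of_reference {E : Type*} [PseudoMetricSpace E] {s : ℕ → E} {x : E} {b : ℕ → ℝ}
    (href : ∀ k : ℕ, 1 ≤ k → dist (s k) x ≤ b k) {k k' : ℕ} (hk : 1 ≤ k) (hk' : 1 ≤ k') :
    dist (s k) (s k') ≤ b k + b k' := by
  calc dist (s k) (s k') ≤ dist (s k) x + dist x (s k') := dist_triangle _ _ _
    _ = dist (s k) x + dist (s k') x := by rw [dist_comm x]
    _ ≤ b k + b k' := add_le_add (href k hk) (href k' hk')

/-! ## §2 King's factor-by-factor replacement for precomposed multilinear kernels -/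

section Multilinear

variable {𝕜 : Type*} [NontriviallyNormedField 𝕜] {k : ℕ}
  {V₀ V₁ G : Type*} [NormedAddCommGroup V₀] [NormedSpace 𝕜 V₀] [NormedAddCommGroup V₁] [NormedSpace 𝕜 V₁] [NormedAddCommGroup G] [NormedSpace 𝕜 G]

/-- **LIPSCHITZ DEPENDENCE OF `g ∘ (A, …, A)` ON `A`**: `‖g∘A^{⊗k} − g∘B^{⊗k}‖ ≤ k·max(‖A‖,‖B‖)^{k−1}·‖A − B‖·‖g‖` — the map `A ↦ (g ↦ g∘A^{⊗k})` is continuous `k`-linear of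
norm `≤ 1` (Mathlib's `compContinuousLinearMapContinuousMultilinear`), and `ContinuousMultilinearMap.norm_image_sub_le` is King's telescoping «replace one by one every factor …
and bound the error at each step». [cite: King1986, p.664 L31-33; Lemma 4.4 (4.29)-(4.30) p.673] -/
theorem norm_compContinuousLinearMap_sub_le (g : ContinuousMultilinearMap 𝕜 (fun _ : Fin k => V₁) G) (A B : V₀ →L[𝕜] V₁) :
    ‖g.compContinuousLinearMap (fun _ => A) - g.compContinuousLinearMap (fun _ => B)‖ ≤ k * max ‖A‖ ‖B‖ ^ (k - 1) * ‖A - B‖ * ‖g‖ := by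
  set F := ContinuousMultilinearMap.compContinuousLinearMapContinuousMultilinear 𝕜 (fun _ : Fin k => V₀) (fun _ : Fin k => V₁) G with hF
  have hFn : ‖F‖ ≤ 1 := MultilinearMap.mkContinuous_norm_le _ zero_le_one _
  have hA : ‖(fun _ : Fin k => A)‖ ≤ ‖A‖ := pi_norm_const_le A
  have hB : ‖(fun _ : Fin k => B)‖ ≤ ‖B‖ := pi_norm_const_le B
  have hAB : ‖(fun _ : Fin k => A) - (fun _ : Fin k => B)‖ ≤ ‖A - B‖ := pi_norm_const_le (A - B)
  have h1 := F.norm_image_sub_le (fun _ => A) (fun _ => B)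
  rw [Fintype.card_fin] at h1
  have key : g.compContinuousLinearMap (fun _ => A) - g.compContinuousLinearMap (fun _ => B) = (F (fun _ => A) - F (fun _ => B)) g := by
    ext v
    simp [hF]
  have h2 : ‖g.compContinuousLinearMap (fun _ => A) - g.compContinuousLinearMap (fun _ => B)‖ ≤ ‖F (fun _ => A) - F (fun _ => B)‖ * ‖g‖ := by
    rw [key]
    exact (F (fun _ => A) - F (fun _ => B)).le_opNorm g
  have hmax : 0 ≤ max ‖A‖ ‖B‖ := le_max_of_le_left (norm_nonneg _)
  calc ‖g.compContinuousLinearMap (fun _ => A) - g.compContinuousLinearMap (fun _ => B)‖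
      ≤ ‖F (fun _ => A) - F (fun _ => B)‖ * ‖g‖ := h2
    _ ≤ (‖F‖ * k * max ‖(fun _ : Fin k => A)‖ ‖(fun _ : Fin k => B)‖ ^ (k - 1) * ‖(fun _ : Fin k => A) - (fun _ : Fin k => B)‖) * ‖g‖ :=
        mul_le_mul_of_nonneg_right h1 (norm_nonneg _)
    _ ≤ (1 * k * max ‖A‖ ‖B‖ ^ (k - 1) * ‖A - B‖) * ‖g‖ := by
        gcongr
    _ = k * max ‖A‖ ‖B‖ ^ (k - 1) * ‖A - B‖ * ‖g‖ := by ring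

/-- The outer difference: `‖g∘A^{⊗k} − g′∘A^{⊗k}‖ ≤ ‖g − g′‖·‖A‖^k` (`norm_compContinuousLinearMap_le`). [folklore] -/
theorem norm_sub_compContinuousLinearMap_le (g g' : ContinuousMultilinearMap 𝕜 (fun _ : Fin k => V₁) G) (A : V₀ →L[𝕜] V₁) :
    ‖g.compContinuousLinearMap (fun _ => A) - g'.compContinuousLinearMap (fun _ => A)‖ ≤ ‖g - g'‖ * ‖A‖ ^ k := by
  have e : g.compContinuousLinearMap (fun _ => A) - g'.compContinuousLinearMap (fun _ => A) = (g - g').compContinuousLinearMap (fun _ => A) := by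
    ext v
    simp
  rw [e]
  refine (ContinuousMultilinearMap.norm_compContinuousLinearMap_le _ _).trans (le_of_eq ?_)
  rw [Finset.prod_const, Finset.card_univ, Fintype.card_fin]

/-- **Associativity of slot-wise precomposition** (constant families): `(g∘T^{⊗k})∘W^{⊗k} = g∘(T∘W)^{⊗k}` — the leg weights are absorbed into the inner maps. [folklore] -/
theorem compContinuousLinearMap_compLeg {V : Type*} [NormedAddCommGroup V] [NormedSpace 𝕜 V]
    (g : ContinuousMultilinearMap 𝕜 (fun _ : Fin k => V₁) G) (T : V₀ →L[𝕜] V₁) (W : V →L[𝕜] V₀) :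
    (g.compContinuousLinearMap fun _ => T).compContinuousLinearMap (fun _ => W) = g.compContinuousLinearMap fun _ => T.comp W := by
  ext v
  simp

/-! ## §3 The K1a-shaped corollary: outer difference + leg-by-leg inner difference, weights absorbed -/

/-- **FACTOR-BY-FACTOR REPLACEMENT IN THE LEG CURRENCY**: for order-`k` kernels `M, M′`, inner linear maps `T, T′` (e.g. two runs' propagator maps) and a weight map `W`
(the row's `legL`), `‖(M∘T^{⊗k} − M′∘T′^{⊗k})∘W^{⊗k}‖ ≤ ‖M − M′‖·‖T∘W‖^k + k·max(‖T∘W‖,‖T′∘W‖)^{k−1}·‖(T − T′)∘W‖·‖M′‖` — the two sources of a two-cut-off difference of a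
composed flat kernel, separated: the outer functional's own difference (at fixed inner maps) and the inner maps' difference, one leg at a time ([King1986] p.664: «replacing one by
one every factor in E^{(k+n)}(H̃) by the corresponding factor in E^{(k)}(H̃), and bounding the error at each step»). [cite: King1986, Prop. 3.6 (3.55)-(3.56) p.662, p.664 L31-33; Balaban1985UV3, (43)-(45) pp.266-267] -/
theorem norm_comp_sub_comp_compLeg_le {V : Type*} [NormedAddCommGroup V] [NormedSpace 𝕜 V]
    (M M' : ContinuousMultilinearMap 𝕜 (fun _ : Fin k => V₁) G) (T T' : V₀ →L[𝕜] V₁) (W : V →L[𝕜] V₀) :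
    ‖(M.compContinuousLinearMap (fun _ => T) - M'.compContinuousLinearMap (fun _ => T')).compContinuousLinearMap (fun _ => W)‖
      ≤ ‖M - M'‖ * ‖T.comp W‖ ^ k + k * max ‖T.comp W‖ ‖T'.comp W‖ ^ (k - 1) * ‖(T - T').comp W‖ * ‖M'‖ := by
  have e : (M.compContinuousLinearMap (fun _ => T) - M'.compContinuousLinearMap (fun _ => T')).compContinuousLinearMap (fun _ => W)
      = (M.compContinuousLinearMap (fun _ => T.comp W) - M'.compContinuousLinearMap (fun _ => T.comp W))
        + (M'.compContinuousLinearMap (fun _ => T.comp W) - M'.compContinuousLinearMap (fun _ => T'.comp W)) := by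
    ext v
    simp
  rw [e]
  refine (norm_add_le _ _).trans (add_le_add (norm_sub_compContinuousLinearMap_le M M' (T.comp W)) ?_)
  have h := norm_compContinuousLinearMap_sub_le M' (T.comp W) (T'.comp W)
  rw [← ContinuousLinearMap.sub_comp] at h
  exact h

end Multilinear

end Summit.QuantumFields.YangMills.Theorems.TwoCutoffReferenceToolkit

end
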